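import Summits.QuantumFields.YangMills.Theorems.BalabanLadderIRTwistedSlabTorusDoubling
import Summits.QuantumFields.YangMills.Theorems.BalabanLadderIRTwistedSlabOneBox
import Summits.QuantumFields.YangMills.Theorems.BalabanLadderIRTwistedSlabClassificationGlue
import HarnessLib

/-!
# T1's residual M4 as ONE typed hypothesis: a doubling polymer representation of `projSlabZ` gives `C·L·e^{−ct}` with `β₀` BEFORE `∀ L` (K48)

HELPER toward stub **T1** `TwistedSlabAnchor` of LINE `twisted-slab-continuity` (crux `IRcof`,
stmt-QuantumFields-26930, census row 43; LEAD prover ym-ir-line-tsc-p1 g7; `--supports` the crux, `--as helper`).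
The glue between the (m6) torus-doubling theorem (K47c `PolymerTorus.norm_polymerLogZ_sub_mul_polymerLogZ_le`) and
T1's own currency `projSlabDefect ρ β z n ℓ₀ L t ≤ C·L·e^{−ct}`:

* `DoublingPolymerRep P₁ P₂ m Y α δ r` — the DATA an M4 line has to produce at one `(β, L, t = m+1)`: an energy shift
  `E`, Kotecký–Preiss activities `w₁` on the subset polymers of `ℤ_{m+1} × Y` and `w₂` on those of `ℤ_{2m+2} × Y`
  with `P₁ = e^{(m+1)E} Ξ(w₁)`, `P₂ = e^{(2m+2)E} Ξ(w₂)` (as complex numbers), agreeing along the double cover on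
  `⌊(m+1)∕2⌋`-short polymers, supported on non-empty time-connected (range `r`) polymers, and obeying hypothesis (1) of
  [KP86] with `d(A) ≥ δ|A|` and one-site size `a{x} ≤ α` — i.e. (m1)(m2)(m4)(m5) of memo §16.3 DELIVERED, nothing more.
* `DoublingPolymerRep.log_doubling_ge`: then `P₁, P₂ > 0` and
  `log P₂ − 2 log P₁ ≥ −4α(m+1)|Y|·e^{−δ⌊(m+1)∕2⌋∕(2r)}` (the energy shifts cancel EXACTLY; K47c prices the rest);
  `DoublingPolymerRep.one_sub_div_sq_le`: `1 − P₂∕P₁² ≤ 4α(m+1)|Y|·e^{−δ⌊(m+1)∕2⌋∕(2r)}` (`1 − e^{−x} ≤ x`).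
* `projSlabDefect_le_of_doublingPolymerRep`: at `P₁ = projSlabZ(…, L, m+1)`, `P₂ = projSlabZ(…, L, 2(m+1))` this is a bound
  on `projSlabDefect ρ β z n ℓ₀ L (m+1)` (any compact `G`, any `ρ`, any box).
* ★ `anchorShape_of_doublingPolymerRep`: if for all `β ≥ β₀`, `L ≥ 2`, `t ≥ 1` such data exist with the SAME `(α, δ, r)`
  and `|Y_L| ≤ κ·L`, then `∃ c > 0, C ≥ 0, ∀ β ≥ β₀, ∀ L ≥ 2, ∀ t ≥ 1, projSlabDefect ≤ C·L·e^{−ct}` — T1's conclusion for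
  the given `(G, ρ, z, n, ℓ₀)` with `β₀` BEFORE `∀ L` (`c = δ∕(8r)`, `C = 32ακr·e^{δ∕(4r)}∕δ`).
* ★★ `twistedSlabAnchor_of_classification_of_doublingPolymerRep`: composed with K41
  `twistedSlabAnchor_of_classification_of_su` — `TwistedSlabAnchor` ⇐ (hcl: the isolating-twist classification, NAMED) ∧
  (hpoly: for every `SU(N)`, generator `ω^k·1`, `n`, faithful `r`, a uniform family of doubling polymer representations
  of `projSlabZ r.ρ β (ω^k·1) n ℓ₀ L ·`). T1 = hcl + hpoly, BY NAME.

So the residual analytic debt of T1 at `SU(N)` (memo §16: "M4") is now ONE typed statement: a `DoublingPolymerRep` family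
with `β`-, `L`-, `t`-uniform constants for `projSlabZ (fundamentalLatticeRep N).ρ β (ω^k·1) n 2 L ·` (and the r-port ∕
K41's `hcl` do the rest). HONEST: this file proves the bookkeeping implication only; producing the representation —
gauge fixing (m1), large∕small-field split (m2), the convergent weak-coupling expansion (m4) and the exact `Z_N`-defect
bookkeeping (m5) — is the wall and is NOT done; T1 0∕1; IRcof ∕ IR 0∕1; the Yang–Mills mass gap (Clay) is NOT proved;
R4 = `BalabanLadder.UV` only.

## References

* [KP86] R. Kotecký, D. Preiss, Comm. Math. Phys. 103 (1986) 491–498, Theorem p. 492, p. 493. [KoteckyPreiss1986]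
* C. Borgs, R. Kotecký, J. Stat. Phys. 61 (1990) 79–119, §1. [BorgsKotecky1990]
* G. 't Hooft, Nucl. Phys. B 153 (1979) 141, §5 (5.1)–(5.4) (the flux-projected twisted partition functions). [tHooft1979Flux]
-/

noncomputable section

open Finset
open scoped BigOperators
open Literature.Probability.LatticeModels
open Literature.MathematicalPhysics.QuantumFieldTheory Literature.MathematicalPhysics.QuantumLattice

namespace Summit.QuantumFields.YangMills.Cruxes.IRcof.TwistedSlab

namespace PolymerTorus

/-! ### An elementary defect bound -/

/-- `1 − P₂∕P₁² ≤ B` as soon as `log P₂ − 2 log P₁ ≥ −B` (`P₁, P₂ > 0`): `P₂∕P₁² = e^{log P₂ − 2 log P₁} ≥ e^{−B} ≥ 1 − B`.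
[folklore] -/
theorem one_sub_div_sq_le_of_log_ge {P₁ P₂ B : ℝ} (h₁ : 0 < P₁) (h₂ : 0 < P₂)
    (hB : -B ≤ Real.log P₂ - 2 * Real.log P₁) : 1 - P₂ / P₁ ^ 2 ≤ B := by
  have hq : P₂ / P₁ ^ 2 = Real.exp (Real.log P₂ - 2 * Real.log P₁) := by
    rw [Real.exp_sub, Real.exp_log h₂, mul_comm, Real.exp_mul, Real.exp_log h₁]
    norm_cast
  rw [hq]
  have h := Real.one_sub_le_exp_neg B
  have hmono : Real.exp (-B) ≤ Real.exp (Real.log P₂ - 2 * Real.log P₁) := Real.exp_le_exp.2 hB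
  linarith

/-! ### The doubling polymer representation at one `(β, L, t)` -/

/-- **A doubling polymer representation** of two real numbers `P₁` (the period-`(m+1)` partition function) and `P₂`
(the period-`(2m+2)` one) on the spatial data `Y`, with Kotecký–Preiss constants `(α, δ, r)`: an energy shift `E`
and activities `w₁`, `w₂` on the subset polymers of `ℤ_{m+1} × Y`, `ℤ_{2m+2} × Y` such that
`P₁ = e^{(m+1)E}·Ξ(w₁)`, `P₂ = e^{(2m+2)E}·Ξ(w₂)`, the activities agree along the double cover on every polymer whose
times lie in an arc of `⌊(m+1)∕2⌋` consecutive times (locality), are supported on non-empty polymers time-connected at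
range `r`, and satisfy hypothesis (1) of [KP86] with size functions `aᵢ ≥ 0`, `dᵢ(A) ≥ δ|A|` and one-site size
`aᵢ{x} ≤ α`. This is what a convergent weak-coupling cluster expansion of the e-flux-projected twisted slab would
deliver (memo `Cruxes/IRcof/T1-ANATOMY-tsc-p1.md` §16.3 (m1)(m2)(m4)(m5)); it is DATA, not a claim. [folklore] -/
structure DoublingPolymerRep (P₁ P₂ : ℝ) (m : ℕ) (Y : Type) [Fintype Y] [DecidableEq Y] (α δ : ℝ) (r : ℕ) where
  /-- the energy (pressure) shift per unit time -/
  E : ℂ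
  /-- activities at period `m + 1` -/
  w₁ : Finset (ZMod (m + 1) × Y) → ℂ
  /-- activities at period `2m + 2` -/
  w₂ : Finset (ZMod (2 * m + 2) × Y) → ℂ
  /-- Kotecký–Preiss size function `a` at period `m + 1` -/
  a₁ : Finset (ZMod (m + 1) × Y) → ℝ
  /-- Kotecký–Preiss size function `d` at period `m + 1` -/
  d₁ : Finset (ZMod (m + 1) × Y) → ℝ
  /-- Kotecký–Preiss size function `a` at period `2m + 2` -/
  a₂ : Finset (ZMod (2 * m + 2) × Y) → ℝ
  /-- Kotecký–Preiss size function `d` at period `2m + 2` -/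
  d₂ : Finset (ZMod (2 * m + 2) × Y) → ℝ
  /-- `P₁ = e^{(m+1)E} Ξ(w₁)` -/
  rep₁ : (P₁ : ℂ) = Complex.exp (((m + 1 : ℕ) : ℂ) * E) *
    polymerPartitionFunction polyInc w₁ (Finset.univ : Finset (Finset (ZMod (m + 1) × Y)))
  /-- `P₂ = e^{(2m+2)E} Ξ(w₂)` -/
  rep₂ : (P₂ : ℂ) = Complex.exp (((2 * m + 2 : ℕ) : ℂ) * E) *
    polymerPartitionFunction polyInc w₂ (Finset.univ : Finset (Finset (ZMod (2 * m + 2) × Y)))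
  /-- locality: the activities agree along the double cover on `⌊(m+1)∕2⌋`-short polymers -/
  loc : ∀ A : Finset (ZMod (2 * m + 2) × Y), IsTimeShort ((m + 1) / 2) A → w₂ A = w₁ (projSet (m + 1) A)
  /-- support: non-empty, time-connected polymers (period `m + 1`) -/
  conn₁ : ∀ A, w₁ A ≠ 0 → A.Nonempty ∧ IsTimeConnected r A
  /-- support: non-empty, time-connected polymers (period `2m + 2`) -/
  conn₂ : ∀ A, w₂ A ≠ 0 → A.Nonempty ∧ IsTimeConnected r A
  /-- `a₁ ≥ 0` -/
  a₁_nonneg : ∀ A, 0 ≤ a₁ A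
  /-- `d₁(A) ≥ δ|A|` -/
  d₁_ge : ∀ A, δ * (A.card : ℝ) ≤ d₁ A
  /-- hypothesis (1) of [KP86] at period `m + 1` -/
  kp₁ : ∀ A, ∑ A' ∈ Finset.univ with polyInc A' A, ‖w₁ A'‖ * Real.exp (a₁ A' + d₁ A') ≤ a₁ A
  /-- one-site size `a₁{x} ≤ α` -/
  a₁_singleton_le : ∀ x, a₁ {x} ≤ α
  /-- `a₂ ≥ 0` -/
  a₂_nonneg : ∀ A, 0 ≤ a₂ A
  /-- `d₂(A) ≥ δ|A|` -/
  d₂_ge : ∀ A, δ * (A.card : ℝ) ≤ d₂ A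
  /-- hypothesis (1) of [KP86] at period `2m + 2` -/
  kp₂ : ∀ A, ∑ A' ∈ Finset.univ with polyInc A' A, ‖w₂ A'‖ * Real.exp (a₂ A' + d₂ A') ≤ a₂ A
  /-- one-site size `a₂{x} ≤ α` -/
  a₂_singleton_le : ∀ x, a₂ {x} ≤ α

namespace DoublingPolymerRep

variable {P₁ P₂ : ℝ} {m : ℕ} {Y : Type} [Fintype Y] [DecidableEq Y] {α δ : ℝ} {r : ℕ}

/-- A non-negative real number represented as `e^{tE}·Ξ(w)` with `w` in the Kotecký–Preiss regime is positive and its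
logarithm is `t·Re E + Re log Ξ(w)` (the Kotecký–Preiss branch `polymerLogZ`). [cite: KoteckyPreiss1986, Theorem p. 492 (Z ≠ 0 and (2))] -/
theorem pos_and_log_eq {X : Type} [Fintype X] [DecidableEq X] {P : ℝ} (hP : 0 ≤ P) {t : ℕ} {E : ℂ}
    {w : Finset X → ℂ} {a d : Finset X → ℝ} (hd : ∀ A, 0 ≤ d A)
    (hKP : ∀ A, ∑ A' ∈ Finset.univ with polyInc A' A, ‖w A'‖ * Real.exp (a A' + d A') ≤ a A)
    (hrep : (P : ℂ) = Complex.exp ((t : ℂ) * E) * polymerPartitionFunction polyInc w Finset.univ) :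
    0 < P ∧ Real.log P = (t : ℝ) * E.re + (polymerLogZ polyInc w Finset.univ).re := by
  have h1 := kp_hypothesis_of_fintype (inc := polyInc) hKP
  have hKPvol : IsKPVolume polyInc w a (Finset.univ : Finset (Finset X)) := isKPVolume_of_tsum_le hd h1 _
  have hZ : polymerPartitionFunction polyInc w Finset.univ = Complex.exp (polymerLogZ polyInc w Finset.univ) :=
    (exp_polymerLogZ_of_kp hKPvol Finset.Subset.rfl).symm
  have hPexp : (P : ℂ) = Complex.exp ((t : ℂ) * E + polymerLogZ polyInc w Finset.univ) := by
    rw [hrep, hZ, Complex.exp_add]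
  have hnorm : P = Real.exp (((t : ℂ) * E + polymerLogZ polyInc w Finset.univ).re) := by
    have h := congrArg (fun u : ℂ => ‖u‖) hPexp
    simp only [Complex.norm_real, Real.norm_eq_abs, Complex.norm_exp] at h
    rwa [abs_of_nonneg hP] at h
  have hpos : 0 < P := by rw [hnorm]; exact Real.exp_pos _
  refine ⟨hpos, ?_⟩
  rw [hnorm, Real.log_exp, Complex.add_re, Complex.mul_re, Complex.natCast_re, Complex.natCast_im]
  ring

/-- **The energy shifts cancel; the torus doubling theorem prices the rest**: for a doubling polymer representation of
non-negative `P₁, P₂`, `P₁, P₂ > 0` and `log P₂ − 2 log P₁ ≥ −4α(m+1)|Y|·e^{−δ⌊(m+1)∕2⌋∕(2r)}`.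
[cite: KoteckyPreiss1986, p. 493 (translation invariant case)] -/
theorem log_doubling_ge (R : DoublingPolymerRep P₁ P₂ m Y α δ r) (hP₁ : 0 ≤ P₁) (hP₂ : 0 ≤ P₂) (hδ : 0 ≤ δ) :
    0 < P₁ ∧ 0 < P₂ ∧
      -(4 * α * ((m + 1 : ℕ) : ℝ) * (Fintype.card Y : ℝ) * Real.exp (-(δ * (((m + 1) / 2 : ℕ) : ℝ) / (2 * r))))
        ≤ Real.log P₂ - 2 * Real.log P₁ := by
  have hd₁ : ∀ A, 0 ≤ R.d₁ A := fun A => (mul_nonneg hδ (Nat.cast_nonneg _)).trans (R.d₁_ge A)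
  have hd₂ : ∀ A, 0 ≤ R.d₂ A := fun A => (mul_nonneg hδ (Nat.cast_nonneg _)).trans (R.d₂_ge A)
  obtain ⟨h₁pos, h₁log⟩ := pos_and_log_eq hP₁ hd₁ R.kp₁ R.rep₁
  obtain ⟨h₂pos, h₂log⟩ := pos_and_log_eq hP₂ hd₂ R.kp₂ R.rep₂
  refine ⟨h₁pos, h₂pos, ?_⟩
  -- the torus doubling theorem, `k = 2`, `n = m + 1`, `N = 2m + 2`, `ℓ = ⌊(m+1)/2⌋`
  have hT := norm_polymerLogZ_sub_mul_polymerLogZ_le (k := 2) (n := m + 1) (N := 2 * m + 2) (by ring)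
    (ℓ := (m + 1) / 2) (by omega) hδ R.loc R.conn₁ R.conn₂ R.a₁_nonneg R.d₁_ge R.kp₁ R.a₂_nonneg R.d₂_ge R.kp₂
  -- the constants: `Σ_x a{x} ≤ α |X|`
  have hS₂ : ∑ x : ZMod (2 * m + 2) × Y, R.a₂ {x} ≤ α * (((2 * m + 2 : ℕ) : ℝ) * Fintype.card Y) := by
    calc ∑ x : ZMod (2 * m + 2) × Y, R.a₂ {x} ≤ ∑ _x : ZMod (2 * m + 2) × Y, α :=
          Finset.sum_le_sum fun x _ => R.a₂_singleton_le x
      _ = α * (((2 * m + 2 : ℕ) : ℝ) * Fintype.card Y) := by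
          rw [Finset.sum_const, nsmul_eq_mul, Finset.card_univ, Fintype.card_prod, ZMod.card, mul_comm]
          push_cast; ring
  have hS₁ : ∑ x : ZMod (m + 1) × Y, R.a₁ {x} ≤ α * (((m + 1 : ℕ) : ℝ) * Fintype.card Y) := by
    calc ∑ x : ZMod (m + 1) × Y, R.a₁ {x} ≤ ∑ _x : ZMod (m + 1) × Y, α :=
          Finset.sum_le_sum fun x _ => R.a₁_singleton_le x
      _ = α * (((m + 1 : ℕ) : ℝ) * Fintype.card Y) := by
          rw [Finset.sum_const, nsmul_eq_mul, Finset.card_univ, Fintype.card_prod, ZMod.card, mul_comm]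
          push_cast; ring
  set ρ₀ := Real.exp (-(δ * (((m + 1) / 2 : ℕ) : ℝ) / (2 * r))) with hρ₀
  have hρ₀nn : 0 ≤ ρ₀ := (Real.exp_pos _).le
  have hbound : ‖polymerLogZ polyInc R.w₂ Finset.univ - (2 : ℕ) * polymerLogZ polyInc R.w₁ Finset.univ‖ ≤
      4 * α * ((m + 1 : ℕ) : ℝ) * (Fintype.card Y : ℝ) * ρ₀ := by
    refine hT.trans ?_
    have h2 : ρ₀ * (∑ x : ZMod (2 * m + 2) × Y, R.a₂ {x} + (2 : ℕ) * ∑ x : ZMod (m + 1) × Y, R.a₁ {x}) ≤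
        ρ₀ * (α * (((2 * m + 2 : ℕ) : ℝ) * Fintype.card Y) + (2 : ℕ) * (α * (((m + 1 : ℕ) : ℝ) * Fintype.card Y))) :=
      mul_le_mul_of_nonneg_left (add_le_add hS₂ (mul_le_mul_of_nonneg_left hS₁ (Nat.cast_nonneg _))) hρ₀nn
    refine h2.trans (le_of_eq ?_)
    push_cast; ring
  -- `log P₂ − 2 log P₁ = Re (log Ξ₂ − 2 log Ξ₁)`: the energy shifts cancel
  have hre : Real.log P₂ - 2 * Real.log P₁ =
      (polymerLogZ polyInc R.w₂ Finset.univ - (2 : ℕ) * polymerLogZ polyInc R.w₁ Finset.univ).re := by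
    rw [h₂log, h₁log, Complex.sub_re, Complex.mul_re, Complex.natCast_re, Complex.natCast_im]
    push_cast; ring
  rw [hre]
  have habs := (Complex.abs_re_le_norm
    (polymerLogZ polyInc R.w₂ Finset.univ - (2 : ℕ) * polymerLogZ polyInc R.w₁ Finset.univ)).trans hbound
  exact neg_le_of_abs_le habs

/-- **Defect bound from a doubling polymer representation**: `1 − P₂∕P₁² ≤ 4α(m+1)|Y|·e^{−δ⌊(m+1)∕2⌋∕(2r)}`.
[cite: KoteckyPreiss1986, p. 493 (translation invariant case)] -/
theorem one_sub_div_sq_le (R : DoublingPolymerRep P₁ P₂ m Y α δ r) (hP₁ : 0 ≤ P₁) (hP₂ : 0 ≤ P₂) (hδ : 0 ≤ δ) :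
    1 - P₂ / P₁ ^ 2 ≤
      4 * α * ((m + 1 : ℕ) : ℝ) * (Fintype.card Y : ℝ) * Real.exp (-(δ * (((m + 1) / 2 : ℕ) : ℝ) / (2 * r))) := by
  obtain ⟨h₁, h₂, h⟩ := R.log_doubling_ge hP₁ hP₂ hδ
  exact one_sub_div_sq_le_of_log_ge h₁ h₂ h

end DoublingPolymerRep

/-! ### In T1's currency -/

section Anchor

variable {G : Type*} [Group G] [TopologicalSpace G] [IsTopologicalGroup G] [CompactSpace G]
  [MeasurableSpace G] [BorelSpace G] {Nc : ℕ}

/-- **`projSlabDefect` from a doubling polymer representation of `projSlabZ`** (any compact `G`, any `ρ`, any box):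
`projSlabDefect ρ β z n ℓ₀ L (m+1) ≤ 4α(m+1)|Y|·e^{−δ⌊(m+1)∕2⌋∕(2r)}`. [cite: tHooft1979Flux, §5 (5.1)–(5.4)] -/
theorem projSlabDefect_le_of_doublingPolymerRep (ρ : G →* Matrix (Fin Nc) (Fin Nc) ℂ) (β : ℝ) (z : G)
    (n ℓ₀ L m : ℕ) {Y : Type} [Fintype Y] [DecidableEq Y] {α δ : ℝ} {r : ℕ} (hδ : 0 ≤ δ)
    (R : DoublingPolymerRep (projSlabZ ρ β z n ℓ₀ L (m + 1)) (projSlabZ ρ β z n ℓ₀ L (2 * (m + 1))) m Y α δ r) :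
    projSlabDefect ρ β z n ℓ₀ L (m + 1) ≤
      4 * α * ((m + 1 : ℕ) : ℝ) * (Fintype.card Y : ℝ) * Real.exp (-(δ * (((m + 1) / 2 : ℕ) : ℝ) / (2 * r))) := by
  unfold projSlabDefect
  exact R.one_sub_div_sq_le (projSlabZ_nonneg ρ β z n ℓ₀ L _) (projSlabZ_nonneg ρ β z n ℓ₀ L _) hδ

/-- The elementary conversion of the (m6) bound into T1's shape: for `t ≥ 1`, `δ > 0`, `r ≥ 1`,
`t · e^{−δ⌊t∕2⌋∕(2r)} ≤ (8r∕δ)·e^{δ∕(4r)} · e^{−(δ∕(8r)) t}`. [folklore] -/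
theorem mul_exp_floor_le {δ : ℝ} {r : ℕ} (hδ : 0 < δ) (hr : 0 < r) (t : ℕ) :
    (t : ℝ) * Real.exp (-(δ * ((t / 2 : ℕ) : ℝ) / (2 * r))) ≤
      (8 * r / δ) * Real.exp (δ / (4 * r)) * Real.exp (-(δ / (8 * r) * t)) := by
  have hr' : (0 : ℝ) < r := by exact_mod_cast hr
  set ε : ℝ := δ / (8 * r) with hε
  have hεpos : 0 < ε := by positivity
  -- `⌊t/2⌋ ≥ (t-1)/2`
  have hfloor : ((t : ℝ) - 1) / 2 ≤ ((t / 2 : ℕ) : ℝ) := by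
    have h : (t : ℝ) ≤ 2 * ((t / 2 : ℕ) : ℝ) + 1 := by exact_mod_cast (by omega : t ≤ 2 * (t / 2) + 1)
    linarith
  have hexp1 : Real.exp (-(δ * ((t / 2 : ℕ) : ℝ) / (2 * r))) ≤ Real.exp (δ / (4 * r)) * Real.exp (-(2 * ε * t)) := by
    rw [← Real.exp_add]
    refine Real.exp_le_exp.2 ?_
    rw [hε]
    have hδr : 0 < δ / (2 * r) := by positivity
    have : δ * ((t / 2 : ℕ) : ℝ) / (2 * r) = δ / (2 * r) * ((t / 2 : ℕ) : ℝ) := by ring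
    rw [this]
    have h2 := mul_le_mul_of_nonneg_left hfloor hδr.le
    have h3 : δ / (4 * ↑r) + -(2 * (δ / (8 * ↑r)) * ↑t) = -(δ / (2 * r) * (((t : ℝ) - 1) / 2)) := by
      field_simp; ring
    rw [h3]
    linarith
  -- `t ≤ e^{ε t}/ε`
  have ht : (t : ℝ) ≤ Real.exp (ε * t) / ε := by
    rw [le_div_iff₀ hεpos]
    have := Real.add_one_le_exp (ε * t)
    nlinarith
  calc (t : ℝ) * Real.exp (-(δ * ((t / 2 : ℕ) : ℝ) / (2 * r)))
      ≤ (Real.exp (ε * t) / ε) * (Real.exp (δ / (4 * r)) * Real.exp (-(2 * ε * t))) :=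
        mul_le_mul ht hexp1 (Real.exp_pos _).le (div_nonneg (Real.exp_pos _).le hεpos.le)
    _ = (1 / ε) * Real.exp (δ / (4 * r)) * (Real.exp (ε * t) * Real.exp (-(2 * ε * t))) := by ring
    _ = (1 / ε) * Real.exp (δ / (4 * r)) * Real.exp (-(ε * t)) := by
        rw [← Real.exp_add]; ring_nf
    _ = (8 * r / δ) * Real.exp (δ / (4 * r)) * Real.exp (-(δ / (8 * r) * t)) := by
        rw [hε]; field_simp

/-- ★ **T1's shape from a uniform family of doubling polymer representations** (`β₀` BEFORE `∀ L`). For a compact group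
`G`, a representation `ρ`, a central-or-not `z`, `n`, `ℓ₀`, a threshold `β₀`, spatial data `Y L` with `|Y L| ≤ κ·L`, and
constants `α ≥ 0`, `δ > 0`, `r ≥ 1`: if for every `β ≥ β₀`, `L ≥ 2` and `m` there is a doubling polymer representation of
`(projSlabZ ρ β z n ℓ₀ L (m+1), projSlabZ ρ β z n ℓ₀ L (2(m+1)))` on `Y L` with constants `(α, δ, r)`, then
`∃ c > 0, C ≥ 0, ∀ β ≥ β₀, ∀ L ≥ 2, ∀ t ≥ 1, projSlabDefect ρ β z n ℓ₀ L t ≤ C·L·e^{−ct}`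
(`c = δ∕(8r)`, `C = 32ακr·e^{δ∕(4r)}∕δ`). With `G = SU(N)`, `z = ω^k·1`, `ℓ₀ = 2` this is the `hsu` hypothesis of K41
`twistedSlabAnchor_of_classification_of_su` for the given `r`: the residual M4 of T1 is exactly such a family.
[cite: tHooft1979Flux, §5 (5.1)–(5.4)] -/
theorem anchorShape_of_doublingPolymerRep (ρ : G →* Matrix (Fin Nc) (Fin Nc) ℂ) (β₀ : ℝ) (z : G) (n ℓ₀ : ℕ)
    (Y : ℕ → Type) [∀ L, Fintype (Y L)] [∀ L, DecidableEq (Y L)] {κ α δ : ℝ} {r : ℕ}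
    (hα : 0 ≤ α) (hδ : 0 < δ) (hr : 0 < r) (hκ : ∀ L, 2 ≤ L → (Fintype.card (Y L) : ℝ) ≤ κ * L)
    (hrep : ∀ β : ℝ, β₀ ≤ β → ∀ L : ℕ, 2 ≤ L → ∀ m : ℕ,
      Nonempty (DoublingPolymerRep (projSlabZ ρ β z n ℓ₀ L (m + 1)) (projSlabZ ρ β z n ℓ₀ L (2 * (m + 1)))
        m (Y L) α δ r)) :
    ∃ c C : ℝ, 0 < c ∧ 0 ≤ C ∧ ∀ β : ℝ, β₀ ≤ β → ∀ L t : ℕ, 2 ≤ L → 1 ≤ t →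
      projSlabDefect ρ β z n ℓ₀ L t ≤ C * (L : ℝ) * Real.exp (-(c * (t : ℝ))) := by
  have hr' : (0 : ℝ) < r := by exact_mod_cast hr
  have hκ0 : 0 ≤ κ := by
    have h := hκ 2 le_rfl
    have h0 : (0 : ℝ) ≤ Fintype.card (Y 2) := Nat.cast_nonneg _
    push_cast at h
    nlinarith
  have hK0 : 0 ≤ (8 * r / δ) * Real.exp (δ / (4 * r)) :=
    mul_nonneg (div_nonneg (by positivity) hδ.le) (Real.exp_pos _).le
  refine ⟨δ / (8 * r), 4 * α * κ * ((8 * r / δ) * Real.exp (δ / (4 * r))), by positivity,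
    mul_nonneg (mul_nonneg (mul_nonneg (by norm_num) hα) hκ0) hK0, ?_⟩
  intro β hβ L t hL ht
  obtain ⟨m, rfl⟩ : ∃ m, t = m + 1 := ⟨t - 1, by omega⟩
  obtain ⟨R⟩ := hrep β hβ L hL m
  have h1 := projSlabDefect_le_of_doublingPolymerRep ρ β z n ℓ₀ L m hδ.le R
  have h2 := mul_exp_floor_le hδ hr (m + 1)
  have hY := hκ L hL
  have hL0 : (0 : ℝ) ≤ L := Nat.cast_nonneg _
  calc projSlabDefect ρ β z n ℓ₀ L (m + 1)
      ≤ 4 * α * ((m + 1 : ℕ) : ℝ) * (Fintype.card (Y L) : ℝ) *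
          Real.exp (-(δ * (((m + 1) / 2 : ℕ) : ℝ) / (2 * r))) := h1
    _ = 4 * α * (Fintype.card (Y L) : ℝ) *
          (((m + 1 : ℕ) : ℝ) * Real.exp (-(δ * (((m + 1) / 2 : ℕ) : ℝ) / (2 * r)))) := by ring
    _ ≤ 4 * α * (κ * L) * ((8 * r / δ) * Real.exp (δ / (4 * r)) * Real.exp (-(δ / (8 * r) * ((m + 1 : ℕ) : ℝ)))) := by
        refine mul_le_mul (mul_le_mul_of_nonneg_left hY (mul_nonneg (by norm_num) hα)) h2
          (mul_nonneg (Nat.cast_nonneg _) (Real.exp_pos _).le)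
          (mul_nonneg (mul_nonneg (by norm_num) hα) (mul_nonneg hκ0 hL0))
    _ = 4 * α * κ * ((8 * r / δ) * Real.exp (δ / (4 * r))) * (L : ℝ) *
          Real.exp (-(δ / (8 * r) * ((m + 1 : ℕ) : ℝ))) := by ring


/-! ### T1 = (classification) + (a uniform doubling polymer representation at `SU(N)`), by name -/

/-- ★★ **`TwistedSlabAnchor` ⇐ hcl ∧ hpoly.** (hcl) is K41's NAMED classification hypothesis (isolating central twist ⇒
`G ≃ SU(N)`, `z ↦ ω^k·1`; Borel–Friedman–Morgan + the classification — cited, not proved); (hpoly) says: for every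
`N ≥ 2`, unit `k`, `n` with `(ω^k·1)^n = 1` and faithful continuous unitary `r` of `SU(N)` there are `ℓ₀ ≥ 2`, `β₀`,
spatial data `Y L` with `|Y L| ≤ κ L` and constants `α ≥ 0`, `δ > 0`, `rr ≥ 1` such that every
`(projSlabZ r.ρ β (ω^k·1) n ℓ₀ L (m+1), projSlabZ r.ρ β (ω^k·1) n ℓ₀ L (2m+2))`, `β ≥ β₀`, `L ≥ 2`, has a doubling polymer
representation on `Y L` with constants `(α, δ, rr)` — the weak-coupling cluster expansion of the e-flux-projected twisted
slab, uniformly in `β`, `L`, `t` (memo §16.3 (m1)(m2)(m4)(m5): the WALL, not proved here). Proof: K41 ∘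
`anchorShape_of_doublingPolymerRep`. HONEST: an implication between hypotheses; T1 0∕1; the Yang–Mills mass gap is NOT
proved. [cite: tHooft1979Flux, §3 and §5 (5.1)–(5.4)] -/
theorem twistedSlabAnchor_of_classification_of_doublingPolymerRep
    (hcl : ∀ (G : Type) [Group G] [TopologicalSpace G] [IsTopologicalGroup G] [CompactSpace G],
      IsCompactSimpleLieGroup G → SimplyConnectedSpace G →
      ∀ z : G, z ∈ Subgroup.center G → z ≠ 1 → HasIsolatingTwist G z →
        ∃ (N : ℕ) (k : ZMod N) (e : G ≃* Matrix.specialUnitaryGroup (Fin N) ℂ),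
          2 ≤ N ∧ IsUnit k ∧ Continuous e ∧ Continuous e.symm ∧
            e z = (suCenter N k : Matrix.specialUnitaryGroup (Fin N) ℂ))
    (hpoly : ∀ (N : ℕ) (k : ZMod N), 2 ≤ N → IsUnit k → ∀ n : ℕ, 0 < n →
      (suCenter N k : Matrix.specialUnitaryGroup (Fin N) ℂ) ^ n = 1 →
      ∀ r : LatticeRep (Matrix.specialUnitaryGroup (Fin N) ℂ),
        ∃ (ℓ₀ : ℕ) (β₀ : ℝ) (Y : ℕ → Type) (_ : ∀ L, Fintype (Y L)) (_ : ∀ L, DecidableEq (Y L))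
          (κ α δ : ℝ) (rr : ℕ), 2 ≤ ℓ₀ ∧ 0 ≤ α ∧ 0 < δ ∧ 0 < rr ∧
          (∀ L, 2 ≤ L → (Fintype.card (Y L) : ℝ) ≤ κ * L) ∧
          ∀ β : ℝ, β₀ ≤ β → ∀ L : ℕ, 2 ≤ L → ∀ m : ℕ,
            Nonempty (DoublingPolymerRep
              (projSlabZ r.ρ β (suCenter N k : Matrix.specialUnitaryGroup (Fin N) ℂ) n ℓ₀ L (m + 1))
              (projSlabZ r.ρ β (suCenter N k : Matrix.specialUnitaryGroup (Fin N) ℂ) n ℓ₀ L (2 * (m + 1)))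
              m (Y L) α δ rr)) :
    TwistedSlabAnchor :=
  twistedSlabAnchor_of_classification_of_su hcl fun N k hN hk n hn hzn r => by
    obtain ⟨ℓ₀, β₀, Y, _, _, κ, α, δ, rr, hℓ₀, hα, hδ, hrr, hκ, hrep⟩ := hpoly N k hN hk n hn hzn r
    obtain ⟨c, C, hc, -, h⟩ := anchorShape_of_doublingPolymerRep r.ρ β₀ _ n ℓ₀ Y hα hδ hrr hκ hrep
    exact ⟨ℓ₀, β₀, c, C, hℓ₀, hc, h⟩

end Anchor

end PolymerTorus

end Summit.QuantumFields.YangMills.Cruxes.IRcof.TwistedSlab
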